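import Literature.Computability.AlgebraicComplexity.GenWordAutomaton
import HarnessLib

/-!
# Words with arbitrary letter sizes: the relative rank of `P_w`

(N. Limaye, S. Srinivasan, S. Tavenas, J. ACM 72 (2025), Art. 26 = FOCS 2021, §2.2, p. 26:9:
"Clearly, the matrices `M_w(P_w)` are full-rank (i.e., have rank equal to either the number of
rows or the number of columns, whichever is smaller). So, `relrk_w(P_w) = 2^{-|w_{[d]}|/2}`";
the general-word form of `WordPolynomialRank.lean`, over `GenWordDefs.lean`.)

For the word polynomial `wordPoly sz pos K` of a word with size function `sz` and signs `pos`
(blocks `X i = BlockVar sz i`), the coefficient matrix of `RelativeRank.lean` has entry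
`(r, c) = [σ(r) ∼ σ(c)]` (`coeffMat_wordPoly`); `r ↦ σ(r)` and `c ↦ σ(c)` are bijections onto the
bit-strings of the respective stream lengths; hence `rank M_w(P_w) = 2^{min}` (`pdRank_wordPoly`),
**`relRank_wordPoly_eq`**: `relrk_w(P_w) = 2^{-|w_{[d]}|/2}`, and `relRank_wordPoly_ge`:
`≥ 2^{-b/2}` whenever `|w_{[d]}| ≤ b`.  Proofs are those of `WordPolynomialRank.lean` with
`letterSize k pos` replaced by `sz` (row/column streams are plain bit-strings here, their lengths
a lemma).

## References

* N. Limaye, S. Srinivasan, S. Tavenas, J. ACM 72 (2025), Art. 26, §2.1, §2.2 (p. 26:9),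
  Lemma 8, Lemma 22.
-/

noncomputable section

open MvPolynomial

namespace Literature.Computability.AlgebraicComplexity

namespace GenWord

open LSTWord (Compat compat_comm compat_iff_prefix_of_le prefix_of_prefix_append posBlocks
  negBlocks)

universe u

variable {d : ℕ} (sz : Fin d → ℕ) (pos : Fin d → Bool) (K : Type u) [Field K]

/-! ### Full monomials and the coefficients of `P_w` -/

/-- Values of the full monomial. [cite: LimayeSrinivasanTavenas2025, §2.1] -/
theorem fullMono_apply (w : (i : Fin d) → BlockVar sz i) (i : Fin d) (x : BlockVar sz i) :
    fullMono sz w ⟨i, x⟩ = if w i = x then 1 else 0 := by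
  unfold fullMono
  rw [Finsupp.finsetSum_apply, Finset.sum_eq_single i]
  · simp only [Finsupp.single_apply, Sigma.mk.inj_iff, heq_eq_eq, true_and]
  · intro j _ hji
    rw [Finsupp.single_apply, if_neg]
    intro h
    exact hji (Sigma.mk.inj_iff.1 h).1
  · intro h; exact absurd (Finset.mem_univ i) h

/-- The full monomial determines the assignment. [cite: LimayeSrinivasanTavenas2025, §2.1] -/
theorem fullMono_injective : Function.Injective (fullMono sz (d := d)) := by
  intro w w' h
  funext i
  have := DFunLike.congr_fun h ⟨i, w i⟩
  rw [fullMono_apply, fullMono_apply, if_pos rfl] at this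
  by_contra hne
  rw [if_neg (fun h' => hne h'.symm)] at this
  exact one_ne_zero this

/-- The product of the variables of an assignment is the monomial of `fullMono`.
[cite: LimayeSrinivasanTavenas2025, §2.1] -/
theorem prod_X_eq_monomial (w : (i : Fin d) → BlockVar sz i) :
    (∏ i : Fin d, X ⟨i, w i⟩ : MvPolynomial (Σ i : Fin d, BlockVar sz i) K) =
      monomial (fullMono sz w) 1 := by
  unfold fullMono
  rw [monomial_sum_one]
  rfl

/-- Gluing row and column assignments realises the sum of their assignment monomials as a full
monomial. [cite: LimayeSrinivasanTavenas2025, §2.1] -/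
theorem assignMonomial_add_eq_fullMono (r : Assignment (BlockVar sz) (posBlocks pos))
    (c : Assignment (BlockVar sz) (negBlocks pos)) :
    assignMonomial (posBlocks pos) r + assignMonomial (negBlocks pos) c =
      fullMono sz (glue sz pos r c) := by
  ext ⟨i, x⟩
  rw [Finsupp.add_apply, assignMonomial_apply, assignMonomial_apply, fullMono_apply, glue]
  by_cases h : pos i = true
  · have hA : i ∈ posBlocks pos := by simp [h]
    have hB : i ∉ negBlocks pos := by simp [h]
    rw [dif_pos hA, dif_neg hB, dif_pos h, add_zero]
  · have hA : i ∉ posBlocks pos := by simp [h]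
    have hB : i ∈ negBlocks pos := by simpa using h
    rw [dif_neg hA, dif_pos hB, dif_neg h, zero_add]

/-- **Coefficients of `P_w`**: the coefficient of the monomial of `w` is `[σ(w⁺) ∼ σ(w⁻)]`.
[cite: LimayeSrinivasanTavenas2025, §2.2] -/
theorem coeff_fullMono_wordPoly (w : (i : Fin d) → BlockVar sz i) :
    coeff (fullMono sz w) (wordPoly sz pos K) =
      if Compat (stream sz pos true w d) (stream sz pos false w d) then 1 else 0 := by
  unfold wordPoly
  rw [coeff_sum, Finset.sum_eq_single w]
  · split_ifs
    · rw [prod_X_eq_monomial, coeff_monomial, if_pos rfl]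
    · rw [coeff_zero]
  · intro w' _ hne
    split_ifs
    · rw [prod_X_eq_monomial, coeff_monomial, if_neg]
      exact fun h => hne (fullMono_injective sz h)
    · rw [coeff_zero]
  · intro h; exact absurd (Finset.mem_univ w) h

/-! ### Streams of rows and of columns -/

/-- The positive stream of a glued assignment is the row stream.
[cite: LimayeSrinivasanTavenas2025, §2.2] -/
theorem stream_true_glue (r : Assignment (BlockVar sz) (posBlocks pos))
    (c : Assignment (BlockVar sz) (negBlocks pos)) :
    stream sz pos true (glue sz pos r c) d = rowStream sz pos r := by
  refine stream_congr sz pos true d fun _ _ hi => ?_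
  simp [glue, hi]

/-- The negative stream of a glued assignment is the column stream.
[cite: LimayeSrinivasanTavenas2025, §2.2] -/
theorem stream_false_glue (r : Assignment (BlockVar sz) (posBlocks pos))
    (c : Assignment (BlockVar sz) (negBlocks pos)) :
    stream sz pos false (glue sz pos r c) d = colStream sz pos c := by
  refine stream_congr sz pos false d fun j _ hi => ?_
  have : ¬ pos j = true := by simp [hi]
  simp [glue, this]

/-- The row stream has the full positive length. [cite: LimayeSrinivasanTavenas2025, §2.2] -/
@[simp]
theorem length_rowStream (r : Assignment (BlockVar sz) (posBlocks pos)) :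
    (rowStream sz pos r).length = streamLen sz pos true d :=
  length_stream _ _ _ _ _

/-- The column stream has the full negative length. [cite: LimayeSrinivasanTavenas2025, §2.2] -/
@[simp]
theorem length_colStream (c : Assignment (BlockVar sz) (negBlocks pos)) :
    (colStream sz pos c).length = streamLen sz pos false d :=
  length_stream _ _ _ _ _

/-- **The coefficient matrix of `P_w`**: entry `(r, c)` is `[σ(r) ∼ σ(c)]` (LST 2025, §2.2).
[cite: LimayeSrinivasanTavenas2025, §2.2] -/
theorem coeffMat_wordPoly (r : Assignment (BlockVar sz) (posBlocks pos))
    (c : Assignment (BlockVar sz) (negBlocks pos)) :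
    coeffMat K (posBlocks pos) (negBlocks pos) (wordPoly sz pos K) r c =
      if Compat (rowStream sz pos r) (colStream sz pos c) then 1 else 0 := by
  rw [coeffMat_apply, assignMonomial_add_eq_fullMono, coeff_fullMono_wordPoly, stream_true_glue,
    stream_false_glue]

/-- A stream determines the labels of the blocks of its sign.
[cite: LimayeSrinivasanTavenas2025, §2.2] -/
theorem eq_of_stream_eq (sgn : Bool) {w w' : (i : Fin d) → BlockVar sz i} (t : ℕ) (ht : t ≤ d)
    (h : stream sz pos sgn w t = stream sz pos sgn w' t) :
    ∀ i : Fin d, (i : ℕ) < t → pos i = sgn → w i = w' i := by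
  induction t with
  | zero => intro i hi; exact absurd hi (Nat.not_lt_zero _)
  | succ t ih =>
    have ht' : t < d := Nat.lt_of_succ_le ht
    rw [stream_succ sz pos sgn w ht', stream_succ sz pos sgn w' ht'] at h
    have hsplit := List.append_inj h (by rw [length_stream, length_stream])
    intro i hi hs
    rcases Nat.lt_succ_iff_lt_or_eq.1 hi with hlt | heq
    · exact ih ht'.le hsplit.1 i hlt hs
    · have hi' : i = ⟨t, ht'⟩ := Fin.ext heq
      subst hi'
      have h2 := hsplit.2
      rw [if_pos hs, if_pos hs] at h2
      exact List.ofFn_injective h2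

/-- `r ↦ σ(r)` is injective. [cite: LimayeSrinivasanTavenas2025, §2.2] -/
theorem rowStream_injective : Function.Injective (rowStream sz pos (d := d)) := by
  intro r r' h
  simp only [rowStream] at h
  funext ⟨i, hi⟩
  have hpos : pos i = true := by simpa using hi
  have := eq_of_stream_eq sz pos true d le_rfl h i i.2 hpos
  simpa [glue, hpos] using this

/-- `c ↦ σ(c)` is injective. [cite: LimayeSrinivasanTavenas2025, §2.2] -/
theorem colStream_injective : Function.Injective (colStream sz pos (d := d)) := by
  intro c c' h
  simp only [colStream] at h
  funext ⟨i, hi⟩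
  have hneg : pos i = false := by simpa using hi
  have := eq_of_stream_eq sz pos false d le_rfl h i i.2 hneg
  have hne : ¬ pos i = true := by simp [hneg]
  simpa [glue, hne] using this

/-- The stream length after `t` blocks is the total letter size of the blocks `i < t` of that
sign. [cite: LimayeSrinivasanTavenas2025, §2.2] -/
theorem streamLen_eq_sum (sgn : Bool) (t : ℕ) (ht : t ≤ d) :
    streamLen sz pos sgn t =
      ∑ i ∈ Finset.univ.filter (fun i : Fin d => (i : ℕ) < t ∧ pos i = sgn), sz i := by
  induction t with
  | zero => simp
  | succ t ih =>
    have ht' : t < d := Nat.lt_of_succ_le ht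
    rw [streamLen_succ sz pos sgn ht', ih ht'.le]
    by_cases hs : pos ⟨t, ht'⟩ = sgn
    · rw [if_pos hs]
      have hsplit : (Finset.univ.filter fun i : Fin d => (i : ℕ) < t + 1 ∧ pos i = sgn) =
          insert ⟨t, ht'⟩ (Finset.univ.filter fun i : Fin d => (i : ℕ) < t ∧ pos i = sgn) := by
        ext i
        simp only [Finset.mem_filter, Finset.mem_univ, true_and, Finset.mem_insert]
        constructor
        · rintro ⟨h1, h2⟩
          rcases Nat.lt_succ_iff_lt_or_eq.1 h1 with h | h
          · exact Or.inr ⟨h, h2⟩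
          · exact Or.inl (Fin.ext h)
        · rintro (rfl | ⟨h1, h2⟩)
          · exact ⟨Nat.lt_succ_self t, hs⟩
          · exact ⟨Nat.lt_succ_of_lt h1, h2⟩
      have hnot : (⟨t, ht'⟩ : Fin d) ∉
          (Finset.univ.filter fun i : Fin d => (i : ℕ) < t ∧ pos i = sgn) := by simp
      rw [hsplit, Finset.sum_insert hnot, add_comm]
    · rw [if_neg hs, add_zero]
      congr 1
      ext i
      simp only [Finset.mem_filter, Finset.mem_univ, true_and]
      constructor
      · rintro ⟨h1, h2⟩; exact ⟨Nat.lt_succ_of_lt h1, h2⟩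
      · rintro ⟨h1, h2⟩
        rcases Nat.lt_succ_iff_lt_or_eq.1 h1 with h | h
        · exact ⟨h, h2⟩
        · exfalso; apply hs; rw [← h2]; congr 1; exact Fin.ext h.symm

/-- The row blocks have `2^{|σ⁺|}` joint labellings: `∏_{i ∈ P_w} 2^{|w_i|} = 2^{∑ |w_i|}`
(LST 2025, §2.1). [cite: LimayeSrinivasanTavenas2025, §2.1] -/
theorem prod_card_posBlocks :
    ∏ i ∈ posBlocks pos, Fintype.card (BlockVar sz i) = 2 ^ streamLen sz pos true d := by
  rw [Finset.prod_congr rfl fun i _ => by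
      rw [Fintype.card_fun, Fintype.card_bool, Fintype.card_fin],
    Finset.prod_pow_eq_pow_sum, streamLen_eq_sum sz pos true d le_rfl]
  congr 1
  refine Finset.sum_congr ?_ fun _ _ => rfl
  ext i; simp

/-- The column blocks have `2^{|σ⁻|}` joint labellings. [cite: LimayeSrinivasanTavenas2025, §2.1] -/
theorem prod_card_negBlocks :
    ∏ i ∈ negBlocks pos, Fintype.card (BlockVar sz i) = 2 ^ streamLen sz pos false d := by
  rw [Finset.prod_congr rfl fun i _ => by
      rw [Fintype.card_fun, Fintype.card_bool, Fintype.card_fin],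
    Finset.prod_pow_eq_pow_sum, streamLen_eq_sum sz pos false d le_rfl]
  congr 1
  refine Finset.sum_congr ?_ fun _ _ => rfl
  ext i; simp

/-- `#rows = 2^{|σ⁺|}`. [cite: LimayeSrinivasanTavenas2025, §2.1] -/
theorem card_rows :
    Fintype.card (Assignment (BlockVar sz) (posBlocks pos)) = 2 ^ streamLen sz pos true d := by
  rw [← prod_card_posBlocks]
  convert card_assignment (X := BlockVar sz) (posBlocks pos)

/-- `#cols = 2^{|σ⁻|}`. [cite: LimayeSrinivasanTavenas2025, §2.1] -/
theorem card_cols :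
    Fintype.card (Assignment (BlockVar sz) (negBlocks pos)) = 2 ^ streamLen sz pos false d := by
  rw [← prod_card_negBlocks]
  convert card_assignment (X := BlockVar sz) (negBlocks pos)

/-- `r ↦ σ(r)` is a bijection onto the bit-strings of the positive length (injective between
sets of the same size `2^{|σ⁺|}`). [cite: LimayeSrinivasanTavenas2025, §2.2] -/
theorem rowStream_bijective :
    Function.Bijective (β := List.Vector Bool (streamLen sz pos true d))
      (fun r : Assignment (BlockVar sz) (posBlocks pos) =>
        ⟨rowStream sz pos r, length_rowStream sz pos r⟩) := by
  rw [Fintype.bijective_iff_injective_and_card]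
  refine ⟨fun r r' h => rowStream_injective sz pos (congrArg Subtype.val h), ?_⟩
  rw [card_rows, card_vector, Fintype.card_bool]

/-- `c ↦ σ(c)` is a bijection onto the bit-strings of the negative length.
[cite: LimayeSrinivasanTavenas2025, §2.2] -/
theorem colStream_bijective :
    Function.Bijective (β := List.Vector Bool (streamLen sz pos false d))
      (fun c : Assignment (BlockVar sz) (negBlocks pos) =>
        ⟨colStream sz pos c, length_colStream sz pos c⟩) := by
  rw [Fintype.bijective_iff_injective_and_card]
  refine ⟨fun c c' h => colStream_injective sz pos (congrArg Subtype.val h), ?_⟩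
  rw [card_cols, card_vector, Fintype.card_bool]

/-- Every bit-string of the positive length is a row stream. [cite: LimayeSrinivasanTavenas2025, §2.2] -/
theorem exists_rowStream_eq (l : List Bool) (hl : l.length = streamLen sz pos true d) :
    ∃ r : Assignment (BlockVar sz) (posBlocks pos), rowStream sz pos r = l := by
  obtain ⟨r, hr⟩ := (rowStream_bijective sz pos).2 ⟨l, hl⟩
  exact ⟨r, congrArg Subtype.val hr⟩

/-- Every bit-string of the negative length is a column stream. [cite: LimayeSrinivasanTavenas2025, §2.2] -/
theorem exists_colStream_eq (l : List Bool) (hl : l.length = streamLen sz pos false d) :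
    ∃ c : Assignment (BlockVar sz) (negBlocks pos), colStream sz pos c = l := by
  obtain ⟨c, hc⟩ := (colStream_bijective sz pos).2 ⟨l, hl⟩
  exact ⟨c, congrArg Subtype.val hc⟩

/-! ### The rank -/

/-- **Full rank, case `|σ⁺| ≤ |σ⁻|`**: the rows of `M_w(P_w)` are linearly independent — the row
of `r` is the only one not vanishing at the column whose stream extends `σ(r)` by zeros.
[cite: LimayeSrinivasanTavenas2025, §2.2] -/
theorem linearIndependent_rows_wordPoly (hle : streamLen sz pos true d ≤ streamLen sz pos false d) :
    LinearIndependent K (coeffMat K (posBlocks pos) (negBlocks pos) (wordPoly sz pos K)) := by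
  classical
  rw [Fintype.linearIndependent_iff]
  intro g hg r₀
  set pad : List Bool := List.replicate (streamLen sz pos false d - streamLen sz pos true d) false
  obtain ⟨c₀, hc₀'⟩ := exists_colStream_eq sz pos (rowStream sz pos r₀ ++ pad) (by
    rw [List.length_append, length_rowStream, List.length_replicate]; omega)
  have hrow : ∀ r, coeffMat K (posBlocks pos) (negBlocks pos) (wordPoly sz pos K) r c₀ =
      if r = r₀ then 1 else 0 := by
    intro r
    rw [coeffMat_wordPoly, hc₀']
    have hlen : (rowStream sz pos r).length ≤ (rowStream sz pos r₀ ++ pad).length := by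
      rw [List.length_append, length_rowStream, length_rowStream]; omega
    have hiff : Compat (rowStream sz pos r) (rowStream sz pos r₀ ++ pad) ↔ r = r₀ := by
      rw [compat_comm, compat_iff_prefix_of_le hlen]
      constructor
      · intro hp
        apply rowStream_injective sz pos
        have hp' := prefix_of_prefix_append hp (by rw [length_rowStream, length_rowStream])
        exact hp'.eq_of_length (by rw [length_rowStream, length_rowStream])
      · rintro rfl; exact List.prefix_append _ _
    by_cases hr : r = r₀
    · rw [if_pos (hiff.2 hr), if_pos hr]
    · rw [if_neg (mt hiff.1 hr), if_neg hr]
  have := congrFun hg c₀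
  simp only [Finset.sum_apply, Pi.smul_apply, hrow, smul_eq_mul, mul_ite, mul_one, mul_zero,
    Finset.sum_ite_eq', Finset.mem_univ, if_true, Pi.zero_apply] at this
  exact this

/-- **Full rank, case `|σ⁻| < |σ⁺|`**: every standard basis vector of the column space is a row
of `M_w(P_w)` (the row of an `r` whose stream extends `σ(c₀)`).
[cite: LimayeSrinivasanTavenas2025, §2.2] -/
theorem single_mem_range_rows_wordPoly (hlt : streamLen sz pos false d < streamLen sz pos true d)
    (c₀ : Assignment (BlockVar sz) (negBlocks pos)) :
    (Pi.single c₀ (1 : K) : Assignment (BlockVar sz) (negBlocks pos) → K) ∈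
      Set.range (coeffMat K (posBlocks pos) (negBlocks pos) (wordPoly sz pos K)) := by
  classical
  set pad : List Bool := List.replicate (streamLen sz pos true d - streamLen sz pos false d) false
  obtain ⟨r₀, hr₀'⟩ := exists_rowStream_eq sz pos (colStream sz pos c₀ ++ pad) (by
    rw [List.length_append, length_colStream, List.length_replicate]; omega)
  refine ⟨r₀, funext fun c => ?_⟩
  rw [coeffMat_wordPoly, hr₀']
  have hlen : (colStream sz pos c).length ≤ (colStream sz pos c₀ ++ pad).length := by
    rw [List.length_append, length_colStream, length_colStream]; omega
  have hiff : Compat (colStream sz pos c₀ ++ pad) (colStream sz pos c) ↔ c = c₀ := by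
    rw [compat_iff_prefix_of_le hlen]
    constructor
    · intro hp
      apply colStream_injective sz pos
      have hp' := prefix_of_prefix_append hp (by rw [length_colStream, length_colStream])
      exact hp'.eq_of_length (by rw [length_colStream, length_colStream])
    · rintro rfl; exact List.prefix_append _ _
  by_cases hc : c = c₀
  · rw [if_pos (hiff.2 hc), hc, Pi.single_eq_same]
  · rw [if_neg (mt hiff.1 hc), Pi.single_eq_of_ne hc]

/-- **`rank M_w(P_w) = 2^{min(|σ⁺|, |σ⁻|)}`** (LST 2025, §2.2: "the matrices `M_w(P_w)` are
full-rank"). [cite: LimayeSrinivasanTavenas2025, §2.2] -/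
theorem pdRank_wordPoly :
    pdRank K (posBlocks pos) (negBlocks pos) (wordPoly sz pos K) =
      2 ^ min (streamLen sz pos true d) (streamLen sz pos false d) := by
  classical
  unfold pdRank
  by_cases hle : streamLen sz pos true d ≤ streamLen sz pos false d
  · rw [min_eq_left hle, finrank_span_eq_card (linearIndependent_rows_wordPoly sz pos K hle),
      card_rows]
  · rw [min_eq_right (le_of_not_ge hle)]
    have htop : Submodule.span K
        (Set.range (coeffMat K (posBlocks pos) (negBlocks pos) (wordPoly sz pos K))) = ⊤ := by
      rw [eq_top_iff]
      intro f _
      rw [← Finset.univ_sum_single f]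
      refine Submodule.sum_mem _ fun c _ => ?_
      have : Pi.single c (f c) = f c • (Pi.single c (1 : K) :
          Assignment (BlockVar sz) (negBlocks pos) → K) := by
        rw [← Pi.single_smul, smul_eq_mul, mul_one]
      rw [this]
      exact Submodule.smul_mem _ _ (Submodule.subset_span
        (single_mem_range_rows_wordPoly sz pos K (not_le.1 hle) c))
    rw [htop, finrank_top, Module.finrank_fintype_fun_eq_card, card_cols]

/-- **`relrk_w(P_w) = 2^{-|w_{[d]}|/2}`** (LST 2025, §2.2, p. 26:9).
[cite: LimayeSrinivasanTavenas2025, §2.2] -/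
theorem relRank_wordPoly_eq :
    (2 : ℝ) ^ (-(overLen sz pos d : ℝ) / 2) = relRank K pos Finset.univ (wordPoly sz pos K) := by
  symm
  unfold relRank relRankPair
  rw [pdRank_wordPoly]
  have hR : (∏ i ∈ posBlocks pos, (Fintype.card (BlockVar sz i) : ℝ)) =
      (2 : ℝ) ^ (streamLen sz pos true d : ℝ) := by
    rw [Real.rpow_natCast]
    exact_mod_cast prod_card_posBlocks sz pos
  have hC : (∏ i ∈ negBlocks pos, (Fintype.card (BlockVar sz i) : ℝ)) =
      (2 : ℝ) ^ (streamLen sz pos false d : ℝ) := by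
    rw [Real.rpow_natCast]
    exact_mod_cast prod_card_negBlocks sz pos
  rw [hR, hC, ← Real.rpow_add (by norm_num : (0 : ℝ) < 2), Real.sqrt_eq_rpow, ← Real.rpow_mul
    (by norm_num : (0 : ℝ) ≤ 2), Nat.cast_pow, Nat.cast_ofNat, ← Real.rpow_natCast,
    ← Real.rpow_sub (by norm_num : (0 : ℝ) < 2)]
  congr 1
  have hov : overLen sz pos d = (streamLen sz pos true d - streamLen sz pos false d) +
      (streamLen sz pos false d - streamLen sz pos true d) := rfl
  rw [hov]
  have h1 : ((min (streamLen sz pos true d) (streamLen sz pos false d) : ℕ) : ℝ) =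
      min (streamLen sz pos true d : ℝ) (streamLen sz pos false d : ℝ) := Nat.cast_min _ _
  rw [h1]
  by_cases h : streamLen sz pos true d ≤ streamLen sz pos false d
  · rw [min_eq_left (by exact_mod_cast h), Nat.sub_eq_zero_of_le h, zero_add, Nat.cast_sub h]
    ring
  · push Not at h
    rw [min_eq_right (by exact_mod_cast h.le), Nat.sub_eq_zero_of_le h.le, add_zero,
      Nat.cast_sub h.le]
    ring

/-- **`relrk_w(P_w) ≥ 2^{-b/2}` when `|w_{[d]}| ≤ b`** (LST 2025, Lemma 8 and Lemma 22:
`relrk_w(P_w) = 2^{-|w_{[d]}|/2} ≥ 2^{-b/2}`). [cite: LimayeSrinivasanTavenas2025, Lemma 8] -/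
theorem relRank_wordPoly_ge {b : ℕ} (hb : overLen sz pos d ≤ b) :
    (2 : ℝ) ^ (-(b : ℝ) / 2) ≤ relRank K pos Finset.univ (wordPoly sz pos K) := by
  rw [← relRank_wordPoly_eq]
  refine Real.rpow_le_rpow_of_exponent_le (by norm_num) ?_
  have : (overLen sz pos d : ℝ) ≤ b := by exact_mod_cast hb
  linarith

end GenWord

end Literature.Computability.AlgebraicComplexity
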